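import Summits.QuantumAdvantage.QuantumAdvantage.Theorems.CharDialCounterSubcubeA

/-! # CharDialCounterSubcube — part 2/2 (mechanical split for landing of `CharDialCounterSubcube`; content verbatim; scopes re-opened with their variables) -/


namespace Summit.QuantumAdvantage.AdviceFreeQNC0
open Finset AffBells22

namespace CounterLaw

section SubProcess
variable {n : ℕ} (p : ℕ) (y : Fin (n + 1) → (Fin n → Bool) → Bool) (W : Finset (Fin n)) (b : Fin n → Bool)
variable [NeZero p]

/-- a frozen step preserves `Q`. -/
theorem Q_lawS_succ_frozen (t : Fin n) (ht : t ∈ W) : Q (lawS p y W b (t.val + 1)) = Q (lawSP p y W b t.val) := by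
  have h : lawS p y W b (t.val + 1) = fun x => lawSP p y W b t.val ((bitEq p (b t)).symm x) := by
    funext x; exact lawS_succ_frozen p y W b t ht x
  rw [h]; exact Q_comp_equiv (bitEq p (b t)).symm _

/-- `Q` does not increase along the process. -/
theorem Q_lawS_succ_le (t : Fin n) : Q (lawS p y W b (t.val + 1)) ≤ Q (lawS p y W b t.val) := by
  rw [← Q_lawSP p y W b t.val]
  by_cases ht : t ∈ W
  · rw [Q_lawS_succ_frozen p y W b t ht]
  · rw [Q_lawS_succ_free p y W b t ht]
    linarith [D2_nonneg p (lawSP p y W b t.val)]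

/-- `Q(lawS 0) = (2ⁿ)²`. -/
theorem Q_lawS_zero : Q (lawS p y W b 0) = ((2 : ℝ) ^ n) ^ 2 := by
  unfold Q
  simp only [lawS_zero]
  rw [Finset.sum_eq_single ((false, false), (0 : ZMod 3), (0 : ZMod p))]
  · simp
  · intro x _ hx; rw [if_neg hx]; ring
  · intro h; exact absurd (mem_univ _) h

/-- Cauchy–Schwarz: `(2ⁿ)² ≤ 12p·Q(lawS t)`. -/
theorem sq_le_Q_lawS (t : ℕ) : ((2 : ℝ) ^ n) ^ 2 ≤ 12 * p * Q (lawS p y W b t) := by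
  have h := sq_sum_le_card_mul_Q (lawS p y W b t)
  rw [sum_lawS, card_St] at h
  push_cast at h; exact h

/-- **the budget over the FREE steps**: `Σ_{t ∉ W} D2(lawSP_t) ≤ 4·(2ⁿ)²·(1 − 1/12p)`. -/
theorem sum_D2_free_le :
    ∑ t ∈ (univ : Finset (Fin n)).filter (fun t => t ∉ W), D2 p (lawSP p y W b t.val)
      ≤ 4 * ((2 : ℝ) ^ n) ^ 2 * (1 - 1 / (12 * p)) := by
  have hfree : ∑ t ∈ (univ : Finset (Fin n)).filter (fun t => t ∉ W), D2 p (lawSP p y W b t.val)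
      = ∑ t ∈ (univ : Finset (Fin n)).filter (fun t => t ∉ W),
          4 * (Q (lawS p y W b t.val) - Q (lawS p y W b (t.val + 1))) := by
    refine sum_congr rfl fun t ht => ?_
    rw [mem_filter] at ht
    rw [Q_lawS_succ_free p y W b t ht.2, Q_lawSP]; ring
  have hmono : ∑ t ∈ (univ : Finset (Fin n)).filter (fun t => t ∉ W),
        4 * (Q (lawS p y W b t.val) - Q (lawS p y W b (t.val + 1)))
      ≤ ∑ t : Fin n, 4 * (Q (lawS p y W b t.val) - Q (lawS p y W b (t.val + 1))) :=
    sum_le_sum_of_subset_of_nonneg (filter_subset _ _)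
      (fun t _ _ => by linarith [Q_lawS_succ_le p y W b t])
  have htel : ∑ t : Fin n, 4 * (Q (lawS p y W b t.val) - Q (lawS p y W b (t.val + 1)))
      = 4 * (Q (lawS p y W b 0) - Q (lawS p y W b n)) := by
    rw [← mul_sum, Fin.sum_univ_eq_sum_range (fun t => Q (lawS p y W b t) - Q (lawS p y W b (t + 1))) n,
      Finset.sum_range_sub']
  rw [hfree]
  refine hmono.trans ?_
  rw [htel, Q_lawS_zero]
  have hp : (0 : ℝ) < 12 * p := by have := NeZero.pos p; positivity
  have h := sq_le_Q_lawS p y W b n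
  have : ((2 : ℝ) ^ n) ^ 2 / (12 * p) ≤ Q (lawS p y W b n) := by rw [div_le_iff₀ hp]; linarith
  have e : 4 * ((2 : ℝ) ^ n) ^ 2 * (1 - 1 / (12 * p)) = 4 * ((2 : ℝ) ^ n) ^ 2 - 4 * (((2 : ℝ) ^ n) ^ 2 / (12 * p)) := by
    ring
  rw [e]; linarith

/-- the number of free positions is `n − |W|`. -/
theorem card_free : ((univ : Finset (Fin n)).filter (fun t => t ∉ W)).card = n - W.card := by
  rw [filter_not, filter_mem_eq_inter, univ_inter, ← compl_eq_univ_sdiff, card_compl, Fintype.card_fin]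

/-- **a good FREE time**: if `12p < m + 1`, `m = n − |W|`, some free `t` has `D1(lawSP_t) ≤ 2·2ⁿ·√(12p/(m+1))`. -/
theorem exists_D1_le_free (hm : 12 * p < (n - W.card) + 1) :
    ∃ t : Fin n, t ∉ W ∧ D1 p (lawSP p y W b t.val) ≤ 2 * (2 : ℝ) ^ n * Real.sqrt (12 * p / ((n - W.card : ℕ) + 1)) := by
  set F := (univ : Finset (Fin n)).filter (fun t => t ∉ W) with hF
  set m := n - W.card with hmdef
  have hcard : F.card = m := card_free W
  have hm0 : 0 < m := by have := NeZero.pos p; omega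
  have hne : F.Nonempty := by rw [← card_pos, hcard]; exact hm0
  set B : ℝ := 4 * ((2 : ℝ) ^ n) ^ 2 * (1 - 1 / (12 * p)) with hB
  obtain ⟨t, ht, hD2⟩ : ∃ t ∈ F, D2 p (lawSP p y W b t.val) ≤ B / m := by
    apply exists_le_of_sum_le hne
    rw [sum_const, hcard, nsmul_eq_mul]
    have e : (m : ℝ) * (B / m) = B := by field_simp
    rw [e]; exact sum_D2_free_le p y W b
  refine ⟨t, (mem_filter.mp ht).2, ?_⟩
  have hp : (0 : ℝ) < p := by exact_mod_cast NeZero.pos p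
  have hm' : (0 : ℝ) < m := by exact_mod_cast hm0
  have hm1 : (0 : ℝ) < (m : ℝ) + 1 := by positivity
  set M : ℝ := (2 : ℝ) ^ n with hM
  have hMpos : 0 < M := by positivity
  have h1 : D1 p (lawSP p y W b t.val) ^ 2 ≤ 12 * p * (B / m) :=
    (sq_D1_le p _).trans (mul_le_mul_of_nonneg_left hD2 (by positivity))
  have h2 : 12 * p * (B / m) ≤ (2 * M) ^ 2 * (12 * p / (m + 1)) := by
    rw [hB]
    have e : 12 * (p : ℝ) * (4 * M ^ 2 * (1 - 1 / (12 * p)) / m) = (2 * M) ^ 2 * ((12 * p - 1) / m) := by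
      field_simp; ring
    rw [e]
    apply mul_le_mul_of_nonneg_left _ (by positivity)
    rw [div_le_div_iff₀ hm' hm1]
    have : (12 * p : ℝ) ≤ m + 1 := by exact_mod_cast hm.le
    nlinarith
  have h3' : D1 p (lawSP p y W b t.val) ^ 2 ≤ (2 * M * Real.sqrt (12 * p / (m + 1))) ^ 2 := by
    rw [mul_pow, Real.sq_sqrt (by positivity)]; exact h1.trans h2
  calc D1 p (lawSP p y W b t.val) = Real.sqrt (D1 p (lawSP p y W b t.val) ^ 2) := (Real.sqrt_sq (D1_nonneg p _)).symm
    _ ≤ Real.sqrt ((2 * M * Real.sqrt (12 * p / (m + 1))) ^ 2) := Real.sqrt_le_sqrt h3'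
    _ = 2 * M * Real.sqrt (12 * p / (m + 1)) := Real.sqrt_sq (by positivity)

/-! ## §5 `Φ` along the subcube process and the assembly -/

/-- `Φ(lawSP_t) ≥ 2ⁿ/3 − p·D1(lawSP_t)`. -/
theorem phi_lawSP_ge (h3 : ¬ 3 ∣ p) (t : ℕ) :
    (2 : ℝ) ^ n / 3 - p * D1 p (lawSP p y W b t) ≤ phi (lawSP p y W b t) := by
  have hthird : (2 : ℝ) ^ n / 3 ≤ phi (lam p (lawSP p y W b t)) := by
    rw [← sum_lawSP p y W b t, ← sum_lam p]
    refine phi_ge_third _ (fun x => ?_) (fun g a b' => lam_const p h3 _ g a b')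
    have h0 := lawSP_nonneg p y W b t
    exact div_nonneg (add_nonneg (add_nonneg (h0 _) (h0 _)) (h0 _)) (by norm_num)
  have hlip := abs_phi_sub_phi_le (lawSP p y W b t) (lam p (lawSP p y W b t))
  have hl := l1_lam_le p (lawSP p y W b t)
  rw [abs_le] at hlip
  linarith [hlip.1]

/-- `Φ` does not decrease along the subcube process. -/
theorem phi_lawSP_mono {t s : ℕ} (hts : t ≤ s) (hs : s ≤ n) : phi (lawSP p y W b t) ≤ phi (lawSP p y W b s) := by
  induction s, hts using Nat.le_induction with
  | base => exact le_rfl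
  | succ s hts ih =>
    have hsn : s < n := hs
    refine (ih hsn.le).trans ?_
    have hbit : phi (lawSP p y W b s) ≤ phi (lawS p y W b (s + 1)) := by
      by_cases hW : (⟨s, hsn⟩ : Fin n) ∈ W
      · have e : (fun x : St p => lawSP p y W b s ((bitEq p (b ⟨s, hsn⟩)).symm x)) = lawS p y W b (s + 1) := by
          funext x; exact (lawS_succ_frozen p y W b ⟨s, hsn⟩ hW x).symm
        rw [← e, phi_comp_bitEq_symm]
      · have h := phi_bit_le (lawSP p y W b s)
        have e : (fun x : St p =>
            (lawSP p y W b s (x.1, x.2.1 - 1, x.2.2) + lawSP p y W b s (x.1, x.2.1 - 2, x.2.2 - 1)) / 2)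
            = lawS p y W b (s + 1) := by
          funext x; exact (lawS_succ_free p y W b ⟨s, hsn⟩ hW x).symm
        rwa [e] at h
    have hfire : phi (lawSP p y W b (s + 1)) = phi (lawS p y W b (s + 1)) := by
      have e : lawSP p y W b (s + 1) = fun x : St p =>
          lawS p y W b (s + 1) (if tabN p y (s + 1) x.2.2 then tog x.2.1 x.1 else x.1, x.2.1, x.2.2) := by
        funext x; exact lawSP_eq p y W b (s + 1) x
      rw [e]; exact phi_fire (lawS p y W b (s + 1)) (tabN p y (s + 1))
    rw [hfire]; exact hbit

/-- the LOSE count on the subcube: `≥ 2ⁿ/3 − p·D1(lawSP_t)` for every `t ≤ n`. -/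
theorem card_loseS_ge (h3 : ¬ 3 ∣ p)
    (hy : ∀ g : Fin (n + 1), ∀ u v : Fin n → Bool, wtPrefix u g.val % p = wtPrefix v g.val % p → y g u = y g v)
    (c : ℕ) {t : ℕ} (ht : t ≤ n) :
    (2 : ℝ) ^ n / 3 - p * D1 p (lawSP p y W b t)
      ≤ ((univ.filter fun u : Fin n → Bool => ringWinU c y (subcubeMerge W b u) = false).card : ℝ) := by
  rw [card_loseS_eq p y W b hy c]
  exact ((phi_lawSP_ge p y W b h3 t).trans (phi_lawSP_mono p y W b ht le_rfl)).trans (phi_le_mass_sum _ _)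

/-- **THE BOUND on a subcube** for GLOBAL counter strategies: `#WIN(merged) ≤ (2/3 + 2p√(12p/(m+1)))·2ⁿ`. -/
theorem card_winS_le (h3 : ¬ 3 ∣ p)
    (hy : ∀ g : Fin (n + 1), ∀ u v : Fin n → Bool, wtPrefix u g.val % p = wtPrefix v g.val % p → y g u = y g v)
    (c : ℕ) :
    ((univ.filter fun u : Fin n → Bool => ringWinU c y (subcubeMerge W b u) = true).card : ℝ)
      ≤ (2 / 3 + 2 * p * Real.sqrt (12 * p / ((n - W.card : ℕ) + 1))) * (2 : ℝ) ^ n := by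
  set m := n - W.card with hmdef
  have hsplit : ((univ.filter fun u : Fin n → Bool => ringWinU c y (subcubeMerge W b u) = true).card : ℝ)
      + ((univ.filter fun u : Fin n → Bool => ringWinU c y (subcubeMerge W b u) = false).card : ℝ)
      = (2 : ℝ) ^ n := by
    have h := card_filter_add_card_filter_not (s := (univ : Finset (Fin n → Bool)))
      (fun u : Fin n → Bool => ringWinU c y (subcubeMerge W b u) = true)
    rw [card_univ, Fintype.card_fun, Fintype.card_bool, Fintype.card_fin] at h
    have e : (univ.filter fun u : Fin n → Bool => ¬ ringWinU c y (subcubeMerge W b u) = true)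
        = univ.filter fun u : Fin n → Bool => ringWinU c y (subcubeMerge W b u) = false := by
      congr 1; ext u; simp
    rw [e] at h
    exact_mod_cast h
  have hp : (0 : ℝ) < p := by exact_mod_cast NeZero.pos p
  have hsq : 0 ≤ Real.sqrt (12 * p / ((m : ℝ) + 1)) := Real.sqrt_nonneg _
  have hM : (0 : ℝ) < (2 : ℝ) ^ n := pow_pos (by norm_num) n
  by_cases hmn : 12 * p < m + 1
  · obtain ⟨t, _, hD⟩ := exists_D1_le_free p y W b hmn
    have hl := card_loseS_ge p y W b h3 hy c (t.isLt.le)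
    have hpD : (p : ℝ) * D1 p (lawSP p y W b t.val)
        ≤ p * (2 * (2 : ℝ) ^ n * Real.sqrt (12 * p / ((m : ℝ) + 1))) :=
      mul_le_mul_of_nonneg_left hD hp.le
    linarith
  · have h1 : 1 ≤ Real.sqrt (12 * p / ((m : ℝ) + 1)) := by
      rw [Real.one_le_sqrt, one_le_div (by positivity)]
      exact_mod_cast not_lt.mp hmn
    have hlose : 0 ≤ ((univ.filter fun u : Fin n → Bool =>
        ringWinU c y (subcubeMerge W b u) = false).card : ℝ) := Nat.cast_nonneg _
    have hp1 : (1 : ℝ) ≤ p := by exact_mod_cast NeZero.pos p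
    have hps : (1 : ℝ) ≤ p * Real.sqrt (12 * p / ((m : ℝ) + 1)) := by
      have := mul_le_mul hp1 h1 zero_le_one hp.le
      rwa [one_mul] at this
    have hco : (2 : ℝ) ^ n ≤ (2 / 3 + 2 * p * Real.sqrt (12 * p / ((m : ℝ) + 1))) * (2 : ℝ) ^ n := by
      have : (1 : ℝ) ≤ 2 / 3 + 2 * p * Real.sqrt (12 * p / ((m : ℝ) + 1)) := by linarith
      nlinarith
    linarith

omit [NeZero p] in
/-- **globalisation**: a strategy counter-measurable ON THE SUBCUBE agrees there with a GLOBAL counter strategy. -/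
theorem exists_global
    (hy : ∀ g : Fin (n + 1), ∀ u v : Fin n → Bool,
        wtPrefix (subcubeMerge W b u) g.val % p = wtPrefix (subcubeMerge W b v) g.val % p →
          y g (subcubeMerge W b u) = y g (subcubeMerge W b v)) :
    ∃ y' : Fin (n + 1) → (Fin n → Bool) → Bool,
      (∀ g : Fin (n + 1), ∀ u v : Fin n → Bool, wtPrefix u g.val % p = wtPrefix v g.val % p → y' g u = y' g v) ∧
      ∀ (c : ℕ) (u : Fin n → Bool), ringWinU c y' (subcubeMerge W b u) = ringWinU c y (subcubeMerge W b u) := by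
  classical
  -- the firing table on residues, read off the subcube (false on residues the subcube never visits)
  let T : Fin (n + 1) → ℕ → Bool := fun g r =>
    if h : ∃ u : Fin n → Bool, wtPrefix (subcubeMerge W b u) g.val % p = r then y g (subcubeMerge W b (Classical.choose h))
    else false
  refine ⟨fun g v => T g (wtPrefix v g.val % p), fun g u v huv => by simp only [huv], fun c u => ?_⟩
  have hT : ∀ g : Fin (n + 1), T g (wtPrefix (subcubeMerge W b u) g.val % p) = y g (subcubeMerge W b u) := by
    intro g
    have h : ∃ u' : Fin n → Bool, wtPrefix (subcubeMerge W b u') g.val % p = wtPrefix (subcubeMerge W b u) g.val % p :=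
      ⟨u, rfl⟩
    simp only [T, dif_pos h]
    exact hy g _ u (Classical.choose_spec h)
  unfold ringWinU
  simp only [hT]

end SubProcess

end CounterLaw

/-! ## §6 The theorems -/

/-- **R13 ON SUBCUBES, SHARP — PROVED for every `p` with `3 ∤ p`.** -/
theorem walkHardFCounterSubcubeSharp (p : ℕ) : WalkHardFCounterSubcubeSharp p := by
  intro h3 hp n c W b y hy
  haveI : NeZero p := ⟨hp.ne'⟩
  obtain ⟨y', hy', hag⟩ := CounterLaw.exists_global p y W b hy
  have e : (univ.filter fun u : Fin n → Bool => ringWinU c y (subcubeMerge W b u) = true)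
      = univ.filter fun u : Fin n → Bool => ringWinU c y' (subcubeMerge W b u) = true := by
    congr 1; ext u; rw [hag c u]
  rw [e]
  exact CounterLaw.card_winS_le p y' W b h3 hy' c

/-- the sharp bound gives the rung (`θ := 5/6`, `m₀ := 1728 p³` free positions). -/
theorem walkHardFCounterSubcube_of_sharp (p : ℕ) (H : WalkHardFCounterSubcubeSharp p) : WalkHardFCounterSubcube p := by
  intro h3 hp0
  refine ⟨5 / 6, by norm_num, 1728 * p ^ 3, fun n c W b y hn hy => ?_⟩
  have hmain := H h3 hp0 n c W b y hy
  have h2 : (0 : ℝ) ≤ (2 : ℝ) ^ n := by positivity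
  refine hmain.trans (mul_le_mul_of_nonneg_right ?_ h2)
  have hp1 : (1 : ℝ) ≤ p := by exact_mod_cast hp0
  have hmn : 1728 * p ^ 3 ≤ n - W.card := by omega
  have hn' : (1728 : ℝ) * p ^ 3 ≤ ((n - W.card : ℕ) : ℝ) + 1 := by
    have : ((1728 * p ^ 3 : ℕ) : ℝ) ≤ ((n - W.card : ℕ) : ℝ) := by exact_mod_cast hmn
    push_cast at this; linarith
  have hpos : (0 : ℝ) < ((n - W.card : ℕ) : ℝ) + 1 := by positivity
  have hfrac : (12 : ℝ) * p / (((n - W.card : ℕ) : ℝ) + 1) ≤ (1 / (12 * p)) ^ 2 := by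
    rw [div_le_iff₀ hpos]
    have : (1 / (12 * (p : ℝ))) ^ 2 * (1728 * p ^ 3) = 12 * p := by
      field_simp; ring
    calc (12 : ℝ) * p = (1 / (12 * (p : ℝ))) ^ 2 * (1728 * p ^ 3) := this.symm
      _ ≤ (1 / (12 * (p : ℝ))) ^ 2 * (((n - W.card : ℕ) : ℝ) + 1) := by
          apply mul_le_mul_of_nonneg_left hn'; positivity
  have hsq : Real.sqrt (12 * p / (((n - W.card : ℕ) : ℝ) + 1)) ≤ 1 / (12 * p) := by
    calc Real.sqrt (12 * p / (((n - W.card : ℕ) : ℝ) + 1)) ≤ Real.sqrt ((1 / (12 * p)) ^ 2) := Real.sqrt_le_sqrt hfrac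
      _ = 1 / (12 * p) := Real.sqrt_sq (by positivity)
  have : 2 * (p : ℝ) * Real.sqrt (12 * p / (((n - W.card : ℕ) : ℝ) + 1)) ≤ 2 * p * (1 / (12 * p)) :=
    mul_le_mul_of_nonneg_left hsq (by positivity)
  have h16 : 2 * (p : ℝ) * (1 / (12 * p)) = 1 / 6 := by field_simp; ring
  linarith

/-- **R13 ON SUBCUBES — PROVED** (`3 ∤ p`, `0 < p`): on any subcube with `≥ 1728 p³` free positions, strategies reading the
merged input only through `W_{<g} mod p` win on at most `(5/6)·2ⁿ` merged inputs. -/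
theorem walkHardFCounterSubcube (p : ℕ) : WalkHardFCounterSubcube p :=
  walkHardFCounterSubcube_of_sharp p (walkHardFCounterSubcubeSharp p)

/-- **the rung for every prime `p ≠ 3`**, in the exact shape of the «SliceDial» annex's `CounterSubcubeHard p` (§31). -/
theorem counterSubcubeHard_of_prime (p : ℕ) [hp : Fact p.Prime] (hp3 : p ≠ 3) :
    ∃ θ : ℝ, θ < 1 ∧ ∃ m₀ : ℕ, ∀ (n c : ℕ) (W : Finset (Fin n)) (b : Fin n → Bool)
      (y : Fin (n + 1) → (Fin n → Bool) → Bool), m₀ + W.card ≤ n →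
      (∀ g : Fin (n + 1), ∀ u v : Fin n → Bool,
          wtPrefix (subcubeMerge W b u) g.val % p = wtPrefix (subcubeMerge W b v) g.val % p →
            y g (subcubeMerge W b u) = y g (subcubeMerge W b v)) →
        ((univ.filter fun u : Fin n → Bool => ringWinU c y (subcubeMerge W b u) = true).card : ℝ) ≤ θ * (2 : ℝ) ^ n :=
  walkHardFCounterSubcube p (fun h => hp3 ((Nat.prime_dvd_prime_iff_eq Nat.prime_three hp.out).mp h).symm) hp.out.pos

/-- `W = ∅`: the subcube rung contains the window-free rung `WalkHardFCounter p` (the merge is the identity). -/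
theorem walkHardFCounter_of_subcube (p : ℕ) [hp : Fact p.Prime] (hp3 : p ≠ 3) : WalkHardFCounter p := by
  obtain ⟨θ, hθ, m₀, h⟩ := counterSubcubeHard_of_prime p hp3
  refine ⟨θ, hθ, m₀, fun n hn c y hy => ?_⟩
  have hm : ∀ u : Fin n → Bool, subcubeMerge ∅ (fun _ => false) u = u := fun u => by
    funext i; simp [subcubeMerge]
  have h' := h n c ∅ (fun _ => false) y (by simpa using hn) (fun g u v huv => by
    rw [hm, hm] at huv ⊢; exact hy g u v huv)
  simpa only [hm] using h'

end Summit.QuantumAdvantage.AdviceFreeQNC0
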